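import Mathlib
import HarnessLib
import Summits.Ventures.LatticeQCDFlow.Scoring.NaiveErrorBar
import Summits.Ventures.LatticeQCDFlow.Scoring.ReplicaChains

/-!
# The Gelman–Rubin statistic in expectation: for independent stationary streams
# `E[B] = 2τ_N σ²`, `E[W] = σ²(N − 2τ_N)/(N − 1)`, and `E[(N−1)W/N + B/N] = σ²` EXACTLY —
# `R̂` reads `2τ_N/N`, for every exact sampler; certified bounds under Doeblin

HONEST FRAMING: exact (Metropolis-corrected) sampling algorithms for lattice gauge theory;
figures of merit are autocorrelation/cost numbers at stated couplings and volumes; no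
continuum-physics claim.

Venture `LatticeQCDFlow` (cell pub-lqcd), topic `Scoring`; FANOUT row 8 (`s0-cpn-nemc`, GEN-14).
NEW WORK of the cell, not a published result; no definition is introduced.  Many-stream flow
sampling is monitored with the potential-scale-reduction statistic built from the between-stream
mean square `B = N Σ_r (A_r − Ā)²/(R − 1)` and the within-stream mean square
`W = (1/R) Σ_r s²_r`; in row 11's vocabulary `B/(NR) = replicaSEsq A R` (the between-replica
squared standard error of the stream means `A_r`) and `s²_r/N = replicaSEsq (X_r ·) N` (the naive
squared error bar of stream `r`, `Scoring/NaiveErrorBar.lean`).  This file computes their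
expectations for pairwise uncorrelated, weakly stationary streams (population level) and for
independent copies of the simulated chain started in its invariant law (Mathlib's
`Kernel.trajMeasure`, through `Scoring/ChainTimeAverage.lean` and Mathlib's `covariance_map_fun`).
Printed counterpart NAMED ONLY: Gelman–Rubin 1992; Vehtari–Gelman–Simpson–Carpenter–Bürkner 2021
(rank-normalised `R̂`); Margossian et al. 2024 (nested `R̂` for many short chains) — nothing cited
as a fact.

## Content (streams `r < R`, `R ≥ 2`, each a window `X_r 0, …, X_r (N−1)` (`N ≥ 2`) with mean `m`,
## `Cov(X_r n, X_r n') = σ² ρ(|n − n'|)`, `ρ 0 = 1`, streams pairwise uncorrelated; `τ_N = tauIntN ρ N`;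
## `A_r` the stream means, `Wn = (1/R) Σ_r s²_r/N = W/N`, `Bn = replicaSEsq A R = B/(NR)`)

* **`integral_withinSEsq_eq`** — `E[Wn] = σ² (N − 2τ_N)/(N(N−1))`;
* **`integral_betweenSEsq_eq`** — `E[Bn] = 2τ_N σ²/(N R)` (so `E[B] = 2τ_N σ² = N · Var(A_r)`);
* **`integral_gelmanRubin_eq`** — `E[(N − 1) Wn + R Bn] = σ²`: the pooled variance estimate
  `V̂ = (N−1)W/N + B/N` is UNBIASED for `σ²` whatever the autocorrelation — and
  `E[R Bn]/E[(N−1) Wn] = 2τ_N/(N − 2τ_N)`: the excess of `V̂/W` over `1` reads the finite-size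
  integrated autocorrelation time, nothing else, once the streams are stationary;
* chain level (`κ` Markov, invariant `π`, `R` pairwise independent copies of the chain from `π` on
  any probability space, `f` bounded measurable, `σ² = Var_π f`, `ρ_f` the true autocorrelation):
  **`replicaChains_gelmanRubin_eq`** — `E[(N−1) Wn + R Bn] = Var_π f` EXACTLY;
  **`replicaChains_between_le_of_doeblin`** / **`replicaChains_within_ge_of_doeblin`** — under
  `κ(x, ·) ≥ ε π` (`ε > 0`): `E[R Bn] ≤ (2/ε − 1) Var_π f/N` and
  `E[(N−1) Wn] ≥ Var_π f (N + 1 − 2/ε)/N`, so `E[R Bn]/E[(N−1)Wn] ≤ (2/ε − 1)/(N + 1 − 2/ε)`: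
  a certificate says how fast the stationary `R̂` excess must die with `N`.

NOT CLAIMED: the expectation of the RATIO `R̂` (only expectations of numerator and denominator);
non-stationary starts (there `B` also carries the squared start bias of
`Scoring/ReplicaChains.lean` — the diagnostic's purpose, not priced here); rank-normalisation;
any number of ours.
-/

noncomputable section

namespace Summit.Ventures.LatticeQCDFlow.Scoring

open MeasureTheory ProbabilityTheory Filter Finset
open scoped ENNReal

/-! ### Population level -/

section Population

variable {Ω' : Type*} {mΩ' : MeasurableSpace Ω'} {μ : Measure Ω'} [IsProbabilityMeasure μ]
variable {X : ℕ → ℕ → Ω' → ℝ} {R N : ℕ}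

/-- **Within-stream mean square**: `E[(1/R) Σ_r s²_r/N] = σ² (N − 2τ_N)/(N(N − 1))`. -/
theorem integral_withinSEsq_eq (hR : R ≠ 0) (hN : 2 ≤ N) (hX : ∀ r < R, ∀ n < N, MemLp (X r n) 2 μ)
    (σ2 : ℝ) (ρ : ℕ → ℝ) (hρ : ρ 0 = 1)
    (hC : ∀ r < R, ∀ n < N, ∀ n' < N, cov[X r n, X r n'; μ] = σ2 * ρ (Nat.dist n n'))
    {m : ℝ} (hmean : ∀ r < R, ∀ n < N, μ[X r n] = m) :
    ∫ ω, (∑ r ∈ range R, replicaSEsq (X r) N ω) / R ∂μ = σ2 * (N - 2 * tauIntN ρ N) / (N * (N - 1)) := by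
  have hR' : (R : ℝ) ≠ 0 := by exact_mod_cast hR
  have hN0 : N ≠ 0 := by omega
  have hint : ∀ r ∈ range R, Integrable (replicaSEsq (X r) N) μ := by
    intro r hr
    have hr' := mem_range.1 hr
    unfold replicaSEsq
    refine Integrable.div_const ?_ _
    refine integrable_finsetSum _ fun n hn => ?_
    have hsub : MemLp (fun ω => X r n ω - replicaMean (X r) N ω) 2 μ :=
      (hX r hr' n (mem_range.1 hn)).sub (memLp_replicaMean (hX r hr'))
    exact hsub.integrable_sq
  rw [integral_div, integral_finsetSum _ hint]
  rw [Finset.sum_congr rfl fun r hr => integral_naiveSEsq_eq' hN (hX r (mem_range.1 hr)) σ2 ρ hρ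
    (hC r (mem_range.1 hr)) (hmean r (mem_range.1 hr)), Finset.sum_const, Finset.card_range,
    nsmul_eq_mul]
  field_simp

/-- **Between-stream mean square**: with the stream means `A_r = (1/N) Σ_n X_r n` pairwise
uncorrelated, `E[replicaSEsq A R] = 2τ_N σ²/(N R)` (`R ≥ 2`). -/
theorem integral_betweenSEsq_eq (hR : 2 ≤ R) (hN : N ≠ 0) (hX : ∀ r < R, ∀ n < N, MemLp (X r n) 2 μ)
    (σ2 : ℝ) (ρ : ℕ → ℝ) (hρ : ρ 0 = 1)
    (hC : ∀ r < R, ∀ n < N, ∀ n' < N, cov[X r n, X r n'; μ] = σ2 * ρ (Nat.dist n n'))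
    {m : ℝ} (hmean : ∀ r < R, ∀ n < N, μ[X r n] = m)
    (hcross : ∀ r < R, ∀ r' < R, r ≠ r' →
      cov[fun ω => (∑ n ∈ range N, X r n ω) / N, fun ω => (∑ n ∈ range N, X r' n ω) / N; μ] = 0) :
    ∫ ω, replicaSEsq (fun r ω => (∑ n ∈ range N, X r n ω) / N) R ω ∂μ
      = 2 * tauIntN ρ N * σ2 / (N * R) := by
  have hR0 : R ≠ 0 := by omega
  have hR' : (R : ℝ) ≠ 0 := by exact_mod_cast hR0
  have hN' : (N : ℝ) ≠ 0 := by exact_mod_cast hN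
  have hA2 : ∀ r < R, MemLp (fun ω => (∑ n ∈ range N, X r n ω) / N) 2 μ := fun r hr =>
    memLp_replicaMean (hX r hr)
  have hmeanA : ∀ r < R, μ[fun ω => (∑ n ∈ range N, X r n ω) / N] = m := by
    intro r hr
    have h := integral_replicaMean (μ := μ) (hX r hr)
    have hrm : replicaMean (X r) N = fun ω => (∑ n ∈ range N, X r n ω) / N := rfl
    rw [hrm] at h
    rw [h, Finset.sum_congr rfl fun n hn => hmean r hr n (mem_range.1 hn), Finset.sum_const,
      Finset.card_range, nsmul_eq_mul]
    field_simp
  have h := integral_replicaSEsq_of_means_eq (μ := μ) hR hA2 hcross hmeanA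
  rw [show μ[replicaSEsq (fun r ω => (∑ n ∈ range N, X r n ω) / N) R]
      = ∫ ω, replicaSEsq (fun r ω => (∑ n ∈ range N, X r n ω) / N) R ω ∂μ from rfl] at h
  rw [h, variance_replicaMean hR0 hA2 hcross]
  rw [Finset.sum_congr rfl fun r hr => variance_mean_range_of_cov_eq (X r) σ2 ρ hρ hN
    (hX r (mem_range.1 hr)) (hC r (mem_range.1 hr)), Finset.sum_const, Finset.card_range,
    nsmul_eq_mul]
  field_simp

/-- **THE GELMAN–RUBIN POOLED ESTIMATE IS UNBIASED FOR `σ²`, WHATEVER THE AUTOCORRELATION.**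
`E[(N − 1) Wn + R Bn] = σ²` with `Wn = (1/R) Σ_r s²_r/N` and `Bn = replicaSEsq A R`
(`(N−1) Wn + R Bn = (N−1)W/N + B/N = V̂`). -/
theorem integral_gelmanRubin_eq (hR : 2 ≤ R) (hN : 2 ≤ N) (hX : ∀ r < R, ∀ n < N, MemLp (X r n) 2 μ)
    (σ2 : ℝ) (ρ : ℕ → ℝ) (hρ : ρ 0 = 1)
    (hC : ∀ r < R, ∀ n < N, ∀ n' < N, cov[X r n, X r n'; μ] = σ2 * ρ (Nat.dist n n'))
    {m : ℝ} (hmean : ∀ r < R, ∀ n < N, μ[X r n] = m)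
    (hcross : ∀ r < R, ∀ r' < R, r ≠ r' →
      cov[fun ω => (∑ n ∈ range N, X r n ω) / N, fun ω => (∑ n ∈ range N, X r' n ω) / N; μ] = 0) :
    ((N : ℝ) - 1) * ∫ ω, (∑ r ∈ range R, replicaSEsq (X r) N ω) / R ∂μ
        + R * ∫ ω, replicaSEsq (fun r ω => (∑ n ∈ range N, X r n ω) / N) R ω ∂μ
      = σ2 := by
  have hR0 : R ≠ 0 := by omega
  have hN0 : N ≠ 0 := by omega
  have hR' : (R : ℝ) ≠ 0 := by exact_mod_cast hR0
  have hN' : (2 : ℝ) ≤ N := by exact_mod_cast hN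
  have hNne : (N : ℝ) ≠ 0 := by positivity
  have hN1 : (N : ℝ) - 1 ≠ 0 := by linarith
  rw [integral_withinSEsq_eq hR0 hN hX σ2 ρ hρ hC hmean,
    integral_betweenSEsq_eq hR hN0 hX σ2 ρ hρ hC hmean hcross]
  field_simp
  ring

end Population

/-! ### Independent copies of the simulated chain -/

section Chains

variable {Ω : Type*} [MeasurableSpace Ω]
variable {κ : Kernel Ω Ω} [IsMarkovKernel κ] {π : Measure Ω} [IsProbabilityMeasure π] {ε : ℝ≥0∞}
variable {Ω' : Type*} {mΩ' : MeasurableSpace Ω'} {μ : Measure Ω'} [IsProbabilityMeasure μ]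
  {X : ℕ → Ω' → (ℕ → Ω)} {R N : ℕ}

/-- The covariance structure of independent stationary copies: equal means `πf`, within-copy
covariances `autocov κ π (f − πf) |n − n'|`, zero across copies, for the observables
`ω ↦ f (X_r ω n)`. -/
theorem replicaChains_stationary_structure (hπ : Kernel.Invariant κ π) {f : Ω → ℝ}
    (hf : Measurable f) {C : ℝ} (hC : ∀ x, |f x| ≤ C) (hXm : ∀ r, Measurable (X r))
    (hlaw : ∀ r < R, μ.map (X r) = Kernel.trajMeasure (X := fun _ : ℕ => Ω) π
      (fun n : ℕ => κ.comap (fun h : (i : ↥(Finset.Iic n)) → Ω => h ⟨n, Finset.mem_Iic.2 le_rfl⟩)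
        (measurable_pi_apply _)))
    (hind : ∀ i < R, ∀ j < R, i ≠ j → IndepFun (X i) (X j) μ) :
    (∀ r < R, ∀ n < N, MemLp (fun ω => f (X r ω n)) 2 μ) ∧
    (∀ r < R, ∀ n < N, μ[fun ω => f (X r ω n)] = ∫ z, f z ∂π) ∧
    (∀ r < R, ∀ n < N, ∀ n' < N, cov[fun ω => f (X r ω n), fun ω => f (X r ω n'); μ]
      = autocov κ π (fun y => f y - ∫ z, f z ∂π) 0
        * (autocov κ π (fun y => f y - ∫ z, f z ∂π) (Nat.dist n n')
          / autocov κ π (fun y => f y - ∫ z, f z ∂π) 0)) ∧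
    (∀ r < R, ∀ r' < R, r ≠ r' →
      cov[fun ω => (∑ n ∈ range N, f (X r ω n)) / N,
        fun ω => (∑ n ∈ range N, f (X r' ω n)) / N; μ] = 0) := by
  have hcoord : ∀ n, Measurable fun x : ℕ → Ω => f (x n) := fun n => hf.comp (measurable_pi_apply n)
  have hmem : ∀ r < R, ∀ n < N, MemLp (fun ω => f (X r ω n)) 2 μ := fun r _ n _ =>
    MemLp.of_bound ((hcoord n).comp (hXm r)).aestronglyMeasurable C
      (ae_of_all _ fun ω => by rw [Real.norm_eq_abs]; exact hC _)
  refine ⟨hmem, fun r hr n _ => ?_, fun r hr n _ n' _ => ?_, fun r hr r' hr' hrr' => ?_⟩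
  · rw [show μ[fun ω => f (X r ω n)] = ∫ ω, f (X r ω n) ∂μ from rfl,
      integral_comp_eq_of_map_eq (hXm r) (hlaw r hr) (hcoord n)]
    exact chain_marginal hπ n hf hC
  · -- transport the covariance to the path law, where it is `chain_covariance`
    have hcm : cov[fun ω => f (X r ω n), fun ω => f (X r ω n'); μ]
        = cov[fun x : ℕ → Ω => f (x n), fun x : ℕ → Ω => f (x n'); μ.map (X r)] := by
      rw [covariance_map_fun (hcoord n).aestronglyMeasurable (hcoord n').aestronglyMeasurable
        (hXm r).aemeasurable]
    rw [hcm, hlaw r hr, chain_covariance hπ hf hC n n']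
    by_cases hvar : autocov κ π (fun y => f y - ∫ z, f z ∂π) 0 = 0
    · have hgm : Measurable fun y => f y - ∫ z, f z ∂π := hf.sub measurable_const
      have hgb : ∀ y, |f y - ∫ z, f z ∂π| ≤ C + |∫ z, f z ∂π| := fun y =>
        (abs_sub _ _).trans (add_le_add (hC y) le_rfl)
      rw [autocov_eq_zero_of_zero_lag hgm hgb hvar, hvar, zero_mul]
    · rw [mul_div_cancel₀ _ hvar]
  · have hAm : Measurable fun x : ℕ → Ω => (∑ n ∈ range N, f (x n)) / N :=
      measurable_timeAverage hf N
    rcases Nat.eq_zero_or_pos N with h0 | hNpos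
    · subst h0
      simp [covariance]
    · have hY2 : ∀ s < R, MemLp (fun ω => (∑ n ∈ range N, f (X s ω n)) / N) 2 μ := fun s _ =>
        memLp_replica_timeAverage hf hC (Nat.pos_iff_ne_zero.1 hNpos) hXm s
      exact ((hind r hr r' hr' hrr').comp hAm hAm).covariance_eq_zero (hY2 r hr) (hY2 r' hr')

/-- **THE GELMAN–RUBIN POOLED ESTIMATE OF INDEPENDENT STATIONARY STREAMS IS UNBIASED FOR
`Var_π f`.**  `κ` Markov with invariant law `π`; `R ≥ 2` pairwise independent copies of the chain
started in `π`, on any probability space; `f` bounded measurable; `N ≥ 2`: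
`E[(N − 1) Wn + R Bn] = Var_π f` (`Wn = (1/R)Σ_r s²_r/N`, `Bn` the between-replica squared
standard error of the stream time averages). -/
theorem replicaChains_gelmanRubin_eq (hπ : Kernel.Invariant κ π) {f : Ω → ℝ} (hf : Measurable f)
    {C : ℝ} (hC : ∀ x, |f x| ≤ C) (hR : 2 ≤ R) (hN : 2 ≤ N) (hXm : ∀ r, Measurable (X r))
    (hlaw : ∀ r < R, μ.map (X r) = Kernel.trajMeasure (X := fun _ : ℕ => Ω) π
      (fun n : ℕ => κ.comap (fun h : (i : ↥(Finset.Iic n)) → Ω => h ⟨n, Finset.mem_Iic.2 le_rfl⟩)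
        (measurable_pi_apply _)))
    (hind : ∀ i < R, ∀ j < R, i ≠ j → IndepFun (X i) (X j) μ) :
    ((N : ℝ) - 1) * ∫ ω, (∑ r ∈ range R, replicaSEsq (fun n ω => f (X r ω n)) N ω) / R ∂μ
        + R * ∫ ω, replicaSEsq (fun r ω => (∑ n ∈ range N, f (X r ω n)) / N) R ω ∂μ
      = autocov κ π (fun y => f y - ∫ z, f z ∂π) 0 := by
  obtain ⟨hmem, hmean, hcov, hcross⟩ :=
    replicaChains_stationary_structure (N := N) hπ hf hC hXm hlaw hind
  by_cases hvar : autocov κ π (fun y => f y - ∫ z, f z ∂π) 0 = 0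
  · -- degenerate observable: use `ρ = 1_{t = 0}`
    have h := integral_gelmanRubin_eq (X := fun r n ω => f (X r ω n)) hR hN hmem 0
      (fun t => if t = 0 then (1 : ℝ) else 0) (by simp)
      (fun r hr n hn n' hn' => by rw [hcov r hr n hn n' hn', hvar, zero_mul, zero_mul])
      hmean hcross
    rw [hvar]
    exact h
  · exact integral_gelmanRubin_eq (X := fun r n ω => f (X r ω n)) hR hN hmem _
      (fun t => autocov κ π (fun y => f y - ∫ z, f z ∂π) t
        / autocov κ π (fun y => f y - ∫ z, f z ∂π) 0) (div_self hvar) hcov hmean hcross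

/-- **The between-stream mean square under a Doeblin certificate**: same setting with
`κ(x, ·) ≥ ε π` (`ε > 0`), `N ≥ 1`: `E[R Bn] ≤ (2/ε − 1) Var_π f/N` (`R Bn = B/N`). -/
theorem replicaChains_between_le_of_doeblin (hπ : Kernel.Invariant κ π)
    (hmin : ∀ x {B : Set Ω}, MeasurableSet B → ε * π B ≤ κ x B) (hε0 : 0 < ε)
    {f : Ω → ℝ} (hf : Measurable f) {C : ℝ} (hC : ∀ x, |f x| ≤ C) (hR : 2 ≤ R) (hN : N ≠ 0)
    (hXm : ∀ r, Measurable (X r))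
    (hlaw : ∀ r < R, μ.map (X r) = Kernel.trajMeasure (X := fun _ : ℕ => Ω) π
      (fun n : ℕ => κ.comap (fun h : (i : ↥(Finset.Iic n)) → Ω => h ⟨n, Finset.mem_Iic.2 le_rfl⟩)
        (measurable_pi_apply _)))
    (hind : ∀ i < R, ∀ j < R, i ≠ j → IndepFun (X i) (X j) μ) :
    R * ∫ ω, replicaSEsq (fun r ω => (∑ n ∈ range N, f (X r ω n)) / N) R ω ∂μ
      ≤ (2 / ε.toReal - 1) * autocov κ π (fun y => f y - ∫ z, f z ∂π) 0 / N := by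
  obtain ⟨hmem, hmean, hcov, hcross⟩ :=
    replicaChains_stationary_structure (N := N) hπ hf hC hXm hlaw hind
  have hR0 : R ≠ 0 := by omega
  have hRpos : (0 : ℝ) < R := by exact_mod_cast Nat.pos_of_ne_zero hR0
  have hA2 : ∀ r < R, MemLp (fun ω => (∑ n ∈ range N, f (X r ω n)) / N) 2 μ := fun r _ =>
    memLp_replica_timeAverage hf hC hN hXm r
  have hmeanA : ∀ r < R, μ[fun ω => (∑ n ∈ range N, f (X r ω n)) / N] = ∫ z, f z ∂π := by
    intro r hr
    rw [show μ[fun ω => (∑ n ∈ range N, f (X r ω n)) / N]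
        = ∫ ω, (∑ n ∈ range N, f (X r ω n)) / N ∂μ from rfl,
      integral_comp_eq_of_map_eq (hXm r) (hlaw r hr) (measurable_timeAverage hf N)]
    exact chain_mean_timeAverage hπ hf hC hN
  have h := integral_replicaSEsq_of_means_eq (μ := μ) hR hA2 hcross hmeanA
  rw [show μ[replicaSEsq (fun r ω => (∑ n ∈ range N, f (X r ω n)) / N) R]
      = ∫ ω, replicaSEsq (fun r ω => (∑ n ∈ range N, f (X r ω n)) / N) R ω ∂μ from rfl] at h
  rw [h, variance_replicaMean hR0 hA2 hcross]
  -- each stream's time average has the certified variance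
  have hVr : ∀ r ∈ range R, Var[fun ω => (∑ n ∈ range N, f (X r ω n)) / N; μ]
      ≤ (2 / ε.toReal - 1) * autocov κ π (fun y => f y - ∫ z, f z ∂π) 0 / N := by
    intro r hr
    have hvm : Var[fun ω => (∑ n ∈ range N, f (X r ω n)) / N; μ]
        = Var[fun x : ℕ → Ω => (∑ n ∈ range N, f (x n)) / N; μ.map (X r)] := by
      rw [variance_map ((measurable_timeAverage hf N).aemeasurable) (hXm r).aemeasurable]
      rfl
    rw [hvm, hlaw r (mem_range.1 hr)]
    exact variance_timeAverage_le_of_doeblin hπ hmin hε0 hf hC hN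
  calc (R : ℝ) * ((∑ r ∈ range R, Var[fun ω => (∑ n ∈ range N, f (X r ω n)) / N; μ]) / (R : ℝ) ^ 2)
      = (∑ r ∈ range R, Var[fun ω => (∑ n ∈ range N, f (X r ω n)) / N; μ]) / R := by
        field_simp
    _ ≤ (∑ _r ∈ range R, (2 / ε.toReal - 1) * autocov κ π (fun y => f y - ∫ z, f z ∂π) 0 / N) / R :=
        div_le_div_of_nonneg_right (Finset.sum_le_sum hVr) hRpos.le
    _ = (2 / ε.toReal - 1) * autocov κ π (fun y => f y - ∫ z, f z ∂π) 0 / N := by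
        rw [Finset.sum_const, Finset.card_range, nsmul_eq_mul]; field_simp

/-- **The within-stream mean square under a Doeblin certificate**: same setting, `N ≥ 2`:
`E[(N − 1) Wn] ≥ Var_π f (N + 1 − 2/ε)/N` (`(N−1) Wn = (N−1)W/N`). -/
theorem replicaChains_within_ge_of_doeblin (hπ : Kernel.Invariant κ π)
    (hmin : ∀ x {B : Set Ω}, MeasurableSet B → ε * π B ≤ κ x B) (hε0 : 0 < ε)
    {f : Ω → ℝ} (hf : Measurable f) {C : ℝ} (hC : ∀ x, |f x| ≤ C) (hR : 2 ≤ R) (hN : 2 ≤ N)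
    (hXm : ∀ r, Measurable (X r))
    (hlaw : ∀ r < R, μ.map (X r) = Kernel.trajMeasure (X := fun _ : ℕ => Ω) π
      (fun n : ℕ => κ.comap (fun h : (i : ↥(Finset.Iic n)) → Ω => h ⟨n, Finset.mem_Iic.2 le_rfl⟩)
        (measurable_pi_apply _)))
    (hind : ∀ i < R, ∀ j < R, i ≠ j → IndepFun (X i) (X j) μ) :
    autocov κ π (fun y => f y - ∫ z, f z ∂π) 0 * (N + 1 - 2 / ε.toReal) / N
      ≤ ((N : ℝ) - 1) * ∫ ω, (∑ r ∈ range R, replicaSEsq (fun n ω => f (X r ω n)) N ω) / R ∂μ := by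
  have hN0 : N ≠ 0 := by omega
  have hGR := replicaChains_gelmanRubin_eq (N := N) hπ hf hC hR hN hXm hlaw hind
  have hB := replicaChains_between_le_of_doeblin (N := N) hπ hmin hε0 hf hC hR hN0 hXm hlaw hind
  have hNpos : (0 : ℝ) < N := by exact_mod_cast Nat.pos_of_ne_zero hN0
  have heq : autocov κ π (fun y => f y - ∫ z, f z ∂π) 0 * (N + 1 - 2 / ε.toReal) / N
      = autocov κ π (fun y => f y - ∫ z, f z ∂π) 0
        - (2 / ε.toReal - 1) * autocov κ π (fun y => f y - ∫ z, f z ∂π) 0 / N := by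
    field_simp
    ring
  rw [heq]
  linarith

end Chains

end Summit.Ventures.LatticeQCDFlow.Scoring

end
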